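import Summits.HodgeConjecture.HodgeConjecture.Theorems.SecondaryPeriodsRiemannWeightOneStubAlgebraisationSmoothAffineChart
import Literature.AlgebraicGeometry.FundamentalGroup.RiemannExistenceEtaleCoordinates
import Mathlib.AlgebraicGeometry.Morphisms.Finite
import Mathlib.AlgebraicGeometry.Morphisms.Proper
import Mathlib.AlgebraicGeometry.Morphisms.QuasiFinite
import HarnessLib

/-!
# Crux `RiemannWeightOne` (stmt-HodgeConjecture-16406), stub `stub_algebraisationSmooth`, part (G2): finite projections of an affine open on complex points

Helper file for the registered stub `stub_algebraisationSmooth` (Serre, GAGA §2 n°6). For an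
affine open `U` of a `ℂ`-scheme `X` locally of finite type and regular functions
`t₁, …, t_e ∈ Γ(X, U)` over which `Γ(X, U)` is integral, the morphism `t : U → 𝔸ᵉ_ℂ` is FINITE,
hence («`f` fini ⇒ `f^an` propre à fibres finies», SGA1 XII 3.2 (v)):

* `FiniteProjection.isFinite_proj` — finiteness of `U → 𝔸ᵉ` (Mathlib `HasAffineProperty` for
  `IsFinite`; the map on global sections is `ℂ[T] → Γ(X, U) ≅ Γ(U, ⊤)`, finite because integral
  and of finite type);
* `FiniteProjection.isCompact_setOf_eval_mem` — `{P ∈ U(ℂ) | t(P) ∈ K}` is compact for `K ⊆ ℂᵉ`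
  compact (the tree's `AlgPoints.isProperMap_map`);
* `FiniteProjection.finite_setOf_eval_eq` / `finite_fibre_algHom` — the fibres of `t` on complex
  points, and on `ℂ`-algebra maps `Γ(X, U) → ℂ`, are finite;
* `FiniteProjection.exists_algHom_coords_eq` — `t` is onto `ℂᵉ` on points when `ℂ[T] → Γ(X, U)`
  is injective (lying over).

## References

* [SGA1] A. Grothendieck, M. Raynaud, SGA 1, Exp. XII Prop. 3.2 (v).
* [SerreGAGA1956] J.-P. Serre, GAGA, §2 n°6.
-/

noncomputable section

set_option linter.dupNamespace false

namespace Summit.HodgeConjecture.HodgeConjecture.Theorems.RiemannWeightOne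

namespace FiniteProjection

open scoped Topology
open CategoryTheory AlgebraicGeometry Filter Set Function
open Literature.AlgebraicGeometry.Motives Literature.AlgebraicGeometry.Motives.AlgPoints
open Literature.NumberTheory.Transcendental (IsAnalytification affineSpaceOver)
open Literature.AlgebraicGeometry.HodgeTheory Literature.AlgebraicGeometry.FundamentalGroup
open AffineChart

attribute [local instance] UniversalHyperplaneSection.sectionsAlgebra

variable {X : SchemeOver ℂ} (U : X.left.affineOpens) {e : ℕ} (t : Fin e → Γ(X.left, ↑U))

/-! ### Integrality in two guises -/

/-- If `B` is integral over `k[t₁, …, t_e]` (elementwise over the adjoined subalgebra) then the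
evaluation map `ℂ[T] → B` is an integral ring homomorphism. [folklore] -/
theorem isIntegral_aeval_of_forall_isIntegral {B : Type*} [CommRing B] [Algebra ℂ B] (t : Fin e → B)
    (hint : ∀ b : B, IsIntegral (Algebra.adjoin ℂ (Set.range t)) b) :
    (MvPolynomial.aeval t : MvPolynomial (Fin e) ℂ →ₐ[ℂ] B).toRingHom.IsIntegral := by
  intro b
  set A := Algebra.adjoin ℂ (Set.range t) with hA
  obtain ⟨p, hpm, hp⟩ := hint b
  -- the corestriction of `aeval t` onto `A`
  have hmem : ∀ q : MvPolynomial (Fin e) ℂ, MvPolynomial.aeval t q ∈ A := fun q => by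
    rw [hA, Algebra.adjoin_range_eq_range_aeval]; exact ⟨q, rfl⟩
  set ρ : MvPolynomial (Fin e) ℂ →ₐ[ℂ] A := (MvPolynomial.aeval t).codRestrict A hmem with hρ
  have hρsurj : Surjective ρ := by
    rintro ⟨a, ha⟩
    rw [hA, Algebra.adjoin_range_eq_range_aeval] at ha
    obtain ⟨q, rfl⟩ := ha
    exact ⟨q, Subtype.ext rfl⟩
  obtain ⟨q, hq⟩ := Polynomial.map_surjective (ρ : MvPolynomial (Fin e) ℂ →+* A) hρsurj p
  obtain ⟨q', hq', -, hq'm⟩ := Polynomial.lifts_and_natDegree_eq_and_monic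
    (p := p) (f := (ρ : MvPolynomial (Fin e) ℂ →+* A)) ⟨q, hq⟩ hpm
  refine ⟨q', hq'm, ?_⟩
  have hcomp : (algebraMap A B).comp (ρ : MvPolynomial (Fin e) ℂ →+* A) =
      (MvPolynomial.aeval t : MvPolynomial (Fin e) ℂ →ₐ[ℂ] B).toRingHom := RingHom.ext fun _ => rfl
  rw [← hcomp, ← Polynomial.eval₂_map, hq']
  exact hp

/-- Conversely, an integral `ℂ`-algebra map `g : ℂ[T] → B` makes `B` integral over `k[g(T₁), …]`.
[folklore] -/
theorem forall_isIntegral_of_isIntegral {B : Type*} [CommRing B] [Algebra ℂ B]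
    (g : MvPolynomial (Fin e) ℂ →ₐ[ℂ] B) (hg : g.toRingHom.IsIntegral) :
    ∀ b : B, IsIntegral (Algebra.adjoin ℂ (Set.range fun i => g (MvPolynomial.X i))) b := by
  intro b
  set A := Algebra.adjoin ℂ (Set.range fun i => g (MvPolynomial.X i)) with hA
  obtain ⟨p, hpm, hp⟩ := hg b
  have hgeq : g = MvPolynomial.aeval fun i => g (MvPolynomial.X i) :=
    MvPolynomial.algHom_ext fun i => by simp
  have hmem : ∀ q : MvPolynomial (Fin e) ℂ, g q ∈ A := fun q => by
    rw [hA, Algebra.adjoin_range_eq_range_aeval, ← hgeq]; exact ⟨q, rfl⟩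
  set ρ : MvPolynomial (Fin e) ℂ →ₐ[ℂ] A := g.codRestrict A hmem with hρ
  refine ⟨p.map (ρ : MvPolynomial (Fin e) ℂ →+* A), hpm.map _, ?_⟩
  rw [Polynomial.eval₂_map]
  exact hp

/-- **`Γ(X, U)` is a finitely generated `ℂ`-algebra** for `U` affine and `X` locally of finite type
over `ℂ` (the scalars are `Γ(Spec ℂ, ⊤) → Γ(X, U)`, of finite type by definition). [folklore] -/
theorem finiteType_scalarRingHom [LocallyOfFiniteType X.hom] :
    (SchemeOver.scalarRingHom X ↑U).FiniteType := by
  -- adapted from `LineProjection.finiteType_structureMap`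
  have h1 : (X.hom.appLE ⊤ ↑U le_top).hom.FiniteType :=
    X.hom.finiteType_appLE (isAffineOpen_top _) U.2 le_top
  have h2 : (Scheme.ΓSpecIso (.of ℂ)).inv.hom.FiniteType :=
    RingHom.FiniteType.of_surjective _ (Scheme.ΓSpecIso (.of ℂ)).symm.commRingCatIsoToRingEquiv.surjective
  exact h1.comp h2

/-- The same as an `Algebra.FiniteType` statement for the sections algebra. [folklore] -/
theorem finiteType_sections [LocallyOfFiniteType X.hom] : Algebra.FiniteType ℂ Γ(X.left, ↑U) :=
  finiteType_scalarRingHom U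

/-! ### Linear algebra: the coordinate functionals -/

/-- The coordinate functionals span the dual of `ℂⁿ`. [folklore] -/
theorem span_proj_eq_top {n : ℕ} : Submodule.span ℂ (Set.range fun i : Fin n =>
    (ContinuousLinearMap.proj i : (Fin n → ℂ) →L[ℂ] ℂ)) = ⊤ :=
  span_eq_top_of_injective_pi _ fun _ _ h => funext fun i => congrFun h i

/-- If functionals `f_j` span the dual of `ℂⁿ` then their joint map is injective. [folklore] -/
theorem injective_pi_of_span_eq_top {n : ℕ} {κ : Type*} (f : κ → (Fin n → ℂ) →L[ℂ] ℂ)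
    (hspan : Submodule.span ℂ (Set.range f) = ⊤) :
    Injective fun x : Fin n → ℂ => fun j : κ => f j x := by
  intro x y h
  have hall : ∀ g' ∈ Submodule.span ℂ (Set.range f), g' (x - y) = 0 := by
    intro g' hg'
    refine Submodule.span_induction ?_ ?_ ?_ ?_ hg'
    · rintro _ ⟨j, rfl⟩
      have := congrFun h j
      simp only at this
      rw [map_sub, this, sub_self]
    · simp
    · intro a b _ _ ha hb
      rw [add_apply, ha, hb, add_zero]
    · intro c a _ ha
      rw [smul_apply, ha, smul_zero]
  funext i
  have h := hall (ContinuousLinearMap.proj i) (hspan ▸ Submodule.mem_top)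
  simpa [sub_eq_zero] using h

/-! ### The finite projection of the open subscheme -/

/-- The coordinates `tₖ` transported to global sections of the open subscheme `U`. [folklore] -/
def tTop : Fin e → Γ((openSubschemeOver X ↑U).left, ⊤) := fun k => (↑U : X.left.Opens).topIso.inv (t k)

/-- The projection `t : U ⟶ 𝔸ᵉ_ℂ`. [folklore] -/
abbrev proj : openSubschemeOver X ↑U ⟶ affineSpaceOver (Fin e) ℂ :=
  AffineCoordinates.coordHom (openSubschemeOver X ↑U) (tTop U t)

/-- **`U → 𝔸ᵉ` is finite** when `Γ(X, U)` is integral over `ℂ[t]` and `X` is locally of finite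
type. [cite: SGA1, Exp. XII Prop. 3.2 (v)] -/
theorem isFinite_proj [LocallyOfFiniteType X.hom]
    (hint : ∀ b : Γ(X.left, ↑U), IsIntegral (Algebra.adjoin ℂ (Set.range t)) b) :
    IsFinite (proj U t).left := by
  -- adapted from `EtaleCoordinates.exists_etaleCoordinates`
  haveI : IsAffine (openSubschemeOver X ↑U).left := U.2
  haveI : IsAffine (affineSpaceOver (Fin e) ℂ).left := inferInstanceAs (IsAffine 𝔸(Fin e; Spec (.of ℂ)))
  rw [AffineCoordinates.coordHom_left, HasAffineProperty.iff_of_isAffine (P := @IsFinite)]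
  refine ⟨inferInstance, ?_⟩
  set g : MvPolynomial (Fin e) ℂ →ₐ[ℂ] Γ(X.left, ↑U) := MvPolynomial.aeval t with hg
  have hgC : g.toRingHom.comp MvPolynomial.C = SchemeOver.scalarRingHom X ↑U :=
    RingHom.ext fun c => by simp [hg]; rfl
  have key : (Literature.NumberTheory.Transcendental.affineSpaceGlobalSectionsIso (Fin e) (.of ℂ)).inv ≫
      (AffineSpace.homOfVector (openSubschemeOver X ↑U).hom (tTop U t)).appTop =
      CommRingCat.ofHom g.toRingHom ≫ (↑U : X.left.Opens).topIso.inv := by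
    apply CommRingCat.hom_ext
    refine MvPolynomial.ringHom_ext (fun c ↦ ?_) (fun i ↦ ?_)
    · change (AffineSpace.homOfVector (openSubschemeOver X ↑U).hom (tTop U t)).appTop
          ((Literature.NumberTheory.Transcendental.affineSpaceGlobalSectionsIso (Fin e) (.of ℂ)).inv (MvPolynomial.C c)) =
        (↑U : X.left.Opens).topIso.inv (g.toRingHom (MvPolynomial.C c))
      rw [EtaleCoordinates.affineSpaceGlobalSectionsIso_inv_C, ← RingHom.comp_apply g.toRingHom MvPolynomial.C c,
        hgC, EtaleCoordinates.topIso_inv_scalarRingHom]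
      exact EtaleCoordinates.appTop_structureMap (AffineCoordinates.coordHom (openSubschemeOver X ↑U) (tTop U t)) c
    · change (AffineSpace.homOfVector (openSubschemeOver X ↑U).hom (tTop U t)).appTop
          ((Literature.NumberTheory.Transcendental.affineSpaceGlobalSectionsIso (Fin e) (.of ℂ)).inv (MvPolynomial.X i)) =
        (↑U : X.left.Opens).topIso.inv (g.toRingHom (MvPolynomial.X i))
      rw [EtaleCoordinates.affineSpaceGlobalSectionsIso_inv_X, AffineSpace.homOfVector_appTop_coord]
      simp [hg, tTop]
  have key' := (Iso.inv_comp_eq _).1 key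
  -- `g` is finite: integral and of finite type
  have hgfin : g.toRingHom.Finite := by
    refine (isIntegral_aeval_of_forall_isIntegral t hint).to_finite ?_
    have hft : (SchemeOver.scalarRingHom X ↑U).FiniteType := finiteType_scalarRingHom U
    rw [← hgC] at hft
    exact hft.of_comp_finiteType
  have h3 : ((Literature.NumberTheory.Transcendental.affineSpaceGlobalSectionsIso (Fin e) (.of ℂ)).hom ≫
      (CommRingCat.ofHom g.toRingHom ≫ (↑U : X.left.Opens).topIso.inv)).hom.Finite := by
    rw [CommRingCat.hom_comp, RingHom.finite_respectsIso.cancel_left_isIso, CommRingCat.hom_comp,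
      RingHom.finite_respectsIso.cancel_right_isIso, CommRingCat.hom_ofHom]
    exact hgfin
  exact key' ▸ h3

/-! ### Complex points of the open subscheme -/

/-- The image of a complex point of the open subscheme lies over `U`. [folklore] -/
theorem pt_map_mem (Q : ComplexPoints (openSubschemeOver X ↑U)) :
    (AlgPoints.map (openSubschemeOverι X ↑U) Q).pt ∈ (↑U : X.left.Opens) := by
  have h : AlgPoints.map (openSubschemeOverι X ↑U) Q ∈ Set.range (AlgPoints.map (openSubschemeOverι X ↑U) :
      ComplexPoints (openSubschemeOver X ↑U) → ComplexPoints X) := ⟨Q, rfl⟩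
  rw [ZariskiLocal.range_map_openSubschemeOverι] at h
  exact h

/-- Restricting twice along a presheaf is restricting once (all parallel maps of opens agree).
[folklore] -/
theorem presheaf_map_map {Y : Scheme} {a b c : Y.Opens} (f : Opposite.op a ⟶ Opposite.op b)
    (g : Opposite.op b ⟶ Opposite.op c) (h : Opposite.op a ⟶ Opposite.op c) (s : Γ(Y, a)) :
    Y.presheaf.map g (Y.presheaf.map f s) = Y.presheaf.map h s := by
  have hh : h = f ≫ g := Quiver.Hom.unop_inj (Subsingleton.elim _ _)
  rw [hh, Y.presheaf.map_comp]
  rfl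

/-- Evaluation of `topIso.inv b` at a point of the open subscheme is evaluation of `b` at its image.
[folklore] -/
theorem eval_tTop (Q : ComplexPoints (openSubschemeOver X ↑U)) (b : Γ(X.left, ↑U)) :
    Q.eval ⊤ trivial ((↑U : X.left.Opens).topIso.inv b) =
      (AlgPoints.map (openSubschemeOverι X ↑U) Q).eval ↑U (pt_map_mem U Q) b := by
  rw [AlgPoints.eval_map]
  have hle : (openSubschemeOverι X ↑U).left ⁻¹ᵁ (↑U : X.left.Opens) ≤ ⊤ := le_top
  rw [← AlgPoints.eval_res Q hle (pt_map_mem U Q)]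
  congr 1
  change (↑U : X.left.Opens).toScheme.presheaf.map (homOfLE hle).op ((↑U : X.left.Opens).topIso.inv b) =
    (↑U : X.left.Opens).ι.app ↑U b
  rw [Scheme.Opens.toScheme_presheaf_map, Scheme.Opens.ι_app_self, Scheme.Opens.topIso_inv]
  exact presheaf_map_map _ _ _ b

/-- The coordinate map of `proj` at `Q` is `(tₖ(Q))ₖ` evaluated at the image point. [folklore] -/
theorem coordMap_tTop (Q : ComplexPoints (openSubschemeOver X ↑U)) :
    AffineCoordinates.coordMap (openSubschemeOver X ↑U) (tTop U t) Q =
      fun k => (AlgPoints.map (openSubschemeOverι X ↑U) Q).eval ↑U (pt_map_mem U Q) (t k) :=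
  funext fun k => eval_tTop U Q (t k)

/-- **Compactness**: `{P ∈ U(ℂ) | t(P) ∈ K}` is compact for `K ⊆ ℂᵉ` compact, when `Γ(X, U)` is
integral over `ℂ[t]`. [cite: SGA1, Exp. XII Prop. 3.2 (v)] -/
theorem isCompact_setOf_eval_mem [LocallyOfFiniteType X.hom]
    (hint : ∀ b : Γ(X.left, ↑U), IsIntegral (Algebra.adjoin ℂ (Set.range t)) b)
    {K : Set (Fin e → ℂ)} (hK : IsCompact K) :
    IsCompact {P : ComplexPoints X | ∃ h : P.pt ∈ (↑U : X.left.Opens), (fun k => P.eval ↑U h (t k)) ∈ K} := by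
  haveI := isFinite_proj U t hint
  have hprop : IsProperMap (AffineCoordinates.coordMap (openSubschemeOver X ↑U) (tTop U t)) := by
    rw [AffineCoordinates.coordMap_eq_comp, ← ComplexPoints.coe_affineHomeomorph_symm]
    exact (ComplexPoints.affineHomeomorph e).symm.isProperMap.comp (AlgPoints.isProperMap_map (L := ℂ) _)
  have hc : IsCompact (AffineCoordinates.coordMap (openSubschemeOver X ↑U) (tTop U t) ⁻¹' K) :=
    hprop.isCompact_preimage hK
  have himg := hc.image (AlgPoints.continuous_map (openSubschemeOverι X ↑U))
  convert himg using 1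
  ext P
  constructor
  · rintro ⟨hP, hPK⟩
    have hmem : P ∈ Set.range (AlgPoints.map (openSubschemeOverι X ↑U) :
        ComplexPoints (openSubschemeOver X ↑U) → ComplexPoints X) := by
      rw [ZariskiLocal.range_map_openSubschemeOverι]; exact hP
    obtain ⟨Q, rfl⟩ := hmem
    refine ⟨Q, ?_, rfl⟩
    rw [Set.mem_preimage, coordMap_tTop]
    exact hPK
  · rintro ⟨Q, hQ, rfl⟩
    refine ⟨pt_map_mem U Q, ?_⟩
    rw [Set.mem_preimage, coordMap_tTop] at hQ
    exact hQ

/-- **Finite fibres**: `{P ∈ U(ℂ) | t(P) = c}` is finite. [cite: SGA1, Exp. XII Prop. 3.2 (v)] -/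
theorem finite_setOf_eval_eq [LocallyOfFiniteType X.hom]
    (hint : ∀ b : Γ(X.left, ↑U), IsIntegral (Algebra.adjoin ℂ (Set.range t)) b) (c : Fin e → ℂ) :
    {P : ComplexPoints X | ∃ h : P.pt ∈ (↑U : X.left.Opens), (fun k => P.eval ↑U h (t k)) = c}.Finite := by
  -- adapted from `LineProjection.finite_preimage_eval`
  haveI := isFinite_proj U t hint
  haveI : LocallyOfFiniteType (openSubschemeOver X ↑U).hom := by
    change LocallyOfFiniteType ((↑U : X.left.Opens).ι ≫ X.hom); infer_instance
  set Qc : ComplexPoints (affineSpaceOver (Fin e) ℂ) := AlgPoints.affinePoint ℂ c with hQc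
  have hfib : ((proj U t).left ⁻¹' {Qc.pt}).Finite := (proj U t).left.finite_preimage_singleton Qc.pt
  have hinj : Function.Injective fun Q : ComplexPoints (openSubschemeOver X ↑U) ↦ Q.pt := by
    intro P Q h
    apply (ComplexPoints.equivClosedPoints (openSubschemeOver X ↑U)).injective
    exact Subtype.ext h
  have hfin : {Q : ComplexPoints (openSubschemeOver X ↑U) |
      AffineCoordinates.coordMap (openSubschemeOver X ↑U) (tTop U t) Q = c}.Finite := by
    refine (hfib.preimage hinj.injOn).subset fun Q hQ => ?_
    have hmap : AlgPoints.map (proj U t) Q = Qc := by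
      rw [← AlgPoints.affinePoint_affineCoords (AlgPoints.map (proj U t) Q), hQc]
      congr 1
      rw [AffineCoordinates.affineCoords_map_coordHom]
      exact hQ
    show (proj U t).left Q.pt ∈ ({Qc.pt} : Set _)
    rw [Set.mem_singleton_iff, ← hmap]
    rfl
  refine (hfin.image (AlgPoints.map (openSubschemeOverι X ↑U))).subset ?_
  rintro P ⟨hP, hPc⟩
  have hmem : P ∈ Set.range (AlgPoints.map (openSubschemeOverι X ↑U) :
      ComplexPoints (openSubschemeOver X ↑U) → ComplexPoints X) := by
    rw [ZariskiLocal.range_map_openSubschemeOverι]; exact hP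
  obtain ⟨Q, rfl⟩ := hmem
  refine ⟨Q, ?_, rfl⟩
  show AffineCoordinates.coordMap (openSubschemeOver X ↑U) (tTop U t) Q = c
  rw [coordMap_tTop]
  exact hPc

/-- **Finite fibres on algebra maps**: the `ℂ`-algebra maps `Γ(X, U) → ℂ` with prescribed values on
the `tₖ` are finitely many. [folklore] -/
theorem finite_fibre_algHom [LocallyOfFiniteType X.hom]
    (hint : ∀ b : Γ(X.left, ↑U), IsIntegral (Algebra.adjoin ℂ (Set.range t)) b) (c : Fin e → ℂ) :
    {ψ : Γ(X.left, ↑U) →ₐ[ℂ] ℂ | (fun k => ψ (t k)) = c}.Finite := by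
  refine ((finite_setOf_eval_eq U t hint c).preimage (pointOf_injective U).injOn).subset fun ψ hψ => ?_
  refine ⟨pt_pointOf_mem U ψ, ?_⟩
  funext k
  rw [eval_pointOf]
  exact congrFun hψ k

/-- **Surjectivity on points** (lying over): if `ℂ[T] → Γ(X, U)` is injective and integral, every
`c ∈ ℂᵉ` is the coordinate vector of some `ℂ`-algebra map `Γ(X, U) → ℂ`. [folklore] -/
theorem exists_algHom_coords_eq
    (hint : ∀ b : Γ(X.left, ↑U), IsIntegral (Algebra.adjoin ℂ (Set.range t)) b)
    (hinj : Injective (MvPolynomial.aeval t : MvPolynomial (Fin e) ℂ →ₐ[ℂ] Γ(X.left, ↑U)))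
    (c : Fin e → ℂ) : ∃ ψ : Γ(X.left, ↑U) →ₐ[ℂ] ℂ, (fun k => ψ (t k)) = c := by
  set g := (MvPolynomial.aeval t : MvPolynomial (Fin e) ℂ →ₐ[ℂ] Γ(X.left, ↑U)).toRingHom with hg
  have hker : RingHom.ker g ≤ RingHom.ker (MvPolynomial.eval c : MvPolynomial (Fin e) ℂ →+* ℂ) := by
    rw [(RingHom.injective_iff_ker_eq_bot g).1 hinj]; exact bot_le
  obtain ⟨Φ, hΦ⟩ := Literature.NumberTheory.Transcendental.AlgHomClosure.exists_ringHom_comp_eq_of_isIntegral g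
    (isIntegral_aeval_of_forall_isIntegral t hint) _ hker
  refine ⟨{ Φ with commutes' := fun z => ?_ }, funext fun k => ?_⟩
  · have h := congrArg (fun f : MvPolynomial (Fin e) ℂ →+* ℂ => f (MvPolynomial.C z)) hΦ
    simp only [RingHom.comp_apply, hg, AlgHom.toRingHom_eq_coe, AlgHom.coe_toRingHom,
      MvPolynomial.algHom_C, MvPolynomial.eval_C] at h
    exact h
  · have h := congrArg (fun f : MvPolynomial (Fin e) ℂ →+* ℂ => f (MvPolynomial.X k)) hΦ
    simp only [RingHom.comp_apply, hg, AlgHom.toRingHom_eq_coe, AlgHom.coe_toRingHom,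
      MvPolynomial.aeval_X, MvPolynomial.eval_X] at h
    exact h

end FiniteProjection

section Registered

open CategoryTheory AlgebraicGeometry Literature.AlgebraicGeometry.Motives

attribute [local instance] UniversalHyperplaneSection.sectionsAlgebra

/-- **Registered sub-goal `stub_algebraisationSmooth_finiteProjection`** of the stub
`stub_algebraisationSmooth` (part (G2): finite projections of an affine open are proper on complex
points, `FiniteProjection.isCompact_setOf_eval_mem`). [cite: SGA1, Exp. XII Prop. 3.2 (v)] -/
theorem stub_algebraisationSmooth_finiteProjection :
    ∀ ⦃X : SchemeOver ℂ⦄ [LocallyOfFiniteType X.hom] (U : X.left.affineOpens) ⦃e : ℕ⦄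
      (t : Fin e → Γ(X.left, ↑U)), (∀ b : Γ(X.left, ↑U), IsIntegral (Algebra.adjoin ℂ (Set.range t)) b) →
      ∀ ⦃K : Set (Fin e → ℂ)⦄, IsCompact K →
        IsCompact {P : ComplexPoints X | ∃ h : P.pt ∈ (↑U : X.left.Opens), (fun k => P.eval ↑U h (t k)) ∈ K} :=
  fun _ _ U _ t hint _ hK => FiniteProjection.isCompact_setOf_eval_mem U t hint hK

end Registered

end Summit.HodgeConjecture.HodgeConjecture.Theorems.RiemannWeightOne

end
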